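import Mathlib.Analysis.SpecialFunctions.Log.Base
import Mathlib.Analysis.SpecialFunctions.Pow.Real
import Mathlib.Analysis.Asymptotics.Lemmas
import Summits.MatrixMultiplication.MatrixMultiplication.Theses.AsymptoticRankCW
import Summits.MatrixMultiplication.MatrixMultiplication.Theorems.AsymptoticRankCWGlueDet3OmegaLaser
import Summits.MatrixMultiplication.MatrixMultiplication.Theorems.AsymptoticRankCWGlueDet3OmegaBlocks
import Literature.Computability.AlgebraicComplexity.AsymptoticRankLimit
import Literature.Computability.AlgebraicComplexity.CoppersmithWinograd1990Proofs
import HarnessLib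

/-!
# `GlueDet3Omega`: `R̃(det₃) = 9 ⇒ ω(ℂ) = 2`
(route `MatrixMultiplication/AsymptoticRankCW`, support item `stmt-MatrixMultiplication-1889`)

The crux `BDet3AsymptoticRank` asserts `asymptoticRank (ε ⊠ ε) = 9` for the Levi-Civita tensor
`ε ∈ ℂ³ ⊗ ℂ³ ⊗ ℂ³` (`ε(a, a+1, a+2) = 1`, `ε(a, a+2, a+1) = -1`, indices mod `3`; `ε ⊠ ε ≅ det₃`,
Conner–Gesmundo–Landsberg–Ventura 2022, Lemma 2.4, and `ε ≅ T_skewcw,2`, ibid. §2.2 / p. 7).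
This file proves the glue `BDet3AsymptoticRank → MatrixMultiplication` UNCONDITIONALLY:

* `isBigO_tensorRank_kroneckerPow_of_asymptoticRank_sq_le` — for any tensor `t` and `c > 1`,
  `R̃(t ⊠ t) ≤ c²` implies `R(t^{⊗N}) = O(c^{(1+ε)N})` for every `ε > 0` (`t^{⊗2n}` is a relabelling
  of `(t ⊠ t)^{⊗n}`, the limit form `R(s^{⊗n})^{1/n} → R̃(s)` of `advxxz2025_asymptoticRank_tendsto`,
  and sub-multiplicativity for odd `N`);
* `exists_restrictsTo_leviCivita_kroneckerPow` — `ε` has SIGNED Coppersmith–Winograd block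
  structure for the blocks `{0} ∪ {1,2}`: all three blocks are the `2 × 2` skew form, a signed
  permutation matrix (`σ = (1 2)`, signs `±1`), so `ε^{⊗3m} ≥ ⟨p_m⟩ ⊗ ⟨2^m,2^m,2^m⟩`
  (`exists_restrictsTo_signedCw_kroneckerPow`, `AsymptoticRankCWGlueDet3OmegaBlocks.lean`);
* `glueDet3Omega_proof` — by the abstract Coppersmith–Winograd bound
  `omega_le_logb_of_laser_restrictions` (`AsymptoticRankCWGlueDet3OmegaLaser.lean`) with `q = 2`,
  `ρ = 3`: `ω(ℂ) ≤ log₂(4·3³/27) = 2`, and `2 ≤ ω(ℂ)` (`omega_two_le`). This is CGLV 2022 §2.2: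
  "`R̃(T_skewcw,2) = 3` would imply `ω = 2`" / §2.3: "`R̃(det₃) = 9` … would imply `ω = 2`".

References: A. Conner, F. Gesmundo, J. M. Landsberg, E. Ventura, *Rank and border rank of
Kronecker powers of tensors and Strassen's laser method*, comput. complexity 31 (2022) =
arXiv:1909.04785, §2.2–2.3; P. Bürgisser, M. Clausen, M. A. Shokrollahi, *Algebraic Complexity
Theory* (1997), Thm. 15.41, Ex. 15.24(7).
-/

-- the Theorems namespace `Summit.MatrixMultiplication.MatrixMultiplication.Theorems` repeats the
-- summit name by design (single-problem summit, D-0017), which trips `linter.dupNamespace`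
set_option linter.dupNamespace false

noncomputable section

open scoped BigOperators
open Filter Asymptotics Finset Topology Literature.Computability.AlgebraicComplexity

namespace Summit.MatrixMultiplication.MatrixMultiplication.Theorems

/-! ## Growth of the Kronecker powers from the asymptotic rank of the Kronecker square -/

section Growth

variable {ι κ μ : Type} [Fintype ι] [Fintype κ] [Fintype μ]

omit [Fintype ι] [Fintype κ] [Fintype μ] in
/-- `t^{⊗(n+n)}` is the relabelling of `(t ⊠ t)^{⊗n}` pairing position `j` with position `n + j`
(CGLV 2022 §1: Kronecker powers are iterated Kronecker products, up to re-grouping).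
[cite: ConnerGesmundoLandsbergVentura2022, §1 (p. 3)] -/
theorem kroneckerPow_add_self_eq_precomp (t : ι → κ → μ → ℂ) (n : ℕ) :
    kroneckerPow t (n + n) = fun a b c =>
      kroneckerPow (kroneckerTensor t t) n
        (fun j => (a (Fin.castAdd n j), a (Fin.natAdd n j)))
        (fun j => (b (Fin.castAdd n j), b (Fin.natAdd n j)))
        (fun j => (c (Fin.castAdd n j), c (Fin.natAdd n j))) := by
  funext a b c
  simp only [kroneckerPow_apply, kroneckerTensor_apply, Fin.prod_univ_add, Finset.prod_mul_distrib]

/-- `R(t^{⊗(n+n)}) ≤ R((t ⊠ t)^{⊗n})` (restriction along the relabelling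
`kroneckerPow_add_self_eq_precomp`; in fact an equality). [cite: ConnerGesmundoLandsbergVentura2022, §1 (p. 3)] -/
theorem tensorRank_kroneckerPow_add_self_le (t : ι → κ → μ → ℂ) (n : ℕ) :
    tensorRank (kroneckerPow t (n + n)) ≤ tensorRank (kroneckerPow (kroneckerTensor t t) n) := by
  rw [kroneckerPow_add_self_eq_precomp]
  exact tensorRank_precomp_le _ _ _ _

/-- **Growth of the Kronecker powers from the asymptotic rank of the Kronecker square**: if
`R̃(t ⊠ t) ≤ c²` with `c > 1` then `R(t^{⊗N}) = O(c^{(1+ε)N})` for every `ε > 0` (i.e.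
`R̃(t) ≤ c`). By the limit form `R(s^{⊗n})^{1/n} → R̃(s)` (ADVXXZ 2025 §3.2 / Fekete,
`advxxz2025_asymptoticRank_tendsto`) applied to `s = t ⊠ t`, eventually
`R(t^{⊗2n}) ≤ R((t ⊠ t)^{⊗n}) < c^{2(1+ε)n}`, and `R(t^{⊗(2n+1)}) ≤ R(t^{⊗2n}) R(t)` by
sub-multiplicativity. [cite: AlmanDuanVassilevskaWilliamsXuXuZhou2025, §3.2] -/
theorem isBigO_tensorRank_kroneckerPow_of_asymptoticRank_sq_le (t : ι → κ → μ → ℂ) (c : ℝ)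
    (hc : 1 < c) (h : asymptoticRank (kroneckerTensor t t) ≤ c ^ 2) (ε : ℝ) (hε : 0 < ε) :
    (fun N : ℕ => (tensorRank (kroneckerPow t N) : ℝ)) =O[atTop]
      fun N : ℕ => c ^ ((1 + ε) * N) := by
  have hc0 : 0 < c := by linarith
  have hc1 : 1 ≤ c := hc.le
  -- `B = c^{2(1+ε)} > c² ≥ R̃(t ⊠ t)`
  set B : ℝ := c ^ (2 * (1 + ε)) with hB
  have hB2 : c ^ 2 < B := by
    rw [hB, show c ^ 2 = c ^ ((2 : ℕ) : ℝ) from (Real.rpow_natCast c 2).symm]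
    exact Real.rpow_lt_rpow_of_exponent_lt hc (by push_cast; linarith)
  have hlt : asymptoticRank (kroneckerTensor t t) < B := lt_of_le_of_lt h hB2
  have hB0 : 0 < B := Real.rpow_pos_of_pos hc0 _
  -- eventually `R((t ⊠ t)^{⊗n}) < B^n`
  have hev := (advxxz2025_asymptoticRank_tendsto (kroneckerTensor t t)).eventually
    (gt_mem_nhds hlt)
  obtain ⟨n₀, hn₀⟩ := eventually_atTop.1 hev
  have hD : ∀ n : ℕ, n₀ ≤ n → 1 ≤ n →
      (tensorRank (kroneckerPow (kroneckerTensor t t) n) : ℝ) < B ^ n := by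
    intro n hn hn1
    have h1 := hn₀ n hn
    have hR0 : (0 : ℝ) ≤ tensorRank (kroneckerPow (kroneckerTensor t t) n) := Nat.cast_nonneg _
    have h2 := pow_lt_pow_left₀ h1 (Real.rpow_nonneg hR0 _) (by omega : n ≠ 0)
    rwa [Real.rpow_inv_natCast_pow hR0 (by omega)] at h2
  -- the constant for odd powers
  set M : ℝ := max 1 (tensorRank (kroneckerPow t 1) : ℝ) with hM
  have hM1 : 1 ≤ M := le_max_left _ _
  have hM0 : 0 ≤ M := by linarith
  have hsmall : ∀ r : ℕ, r < 2 → (tensorRank (kroneckerPow t r) : ℝ) ≤ M := by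
    intro r hr
    interval_cases r
    · exact le_trans (by exact_mod_cast tensorRank_kroneckerPow_zero_le_one t) hM1
    · exact le_max_right _ _
  refine IsBigO.of_bound M ?_
  filter_upwards [eventually_ge_atTop (2 * n₀ + 2)] with N hN
  rw [Real.norm_of_nonneg (Nat.cast_nonneg _), Real.norm_of_nonneg (Real.rpow_pos_of_pos hc0 _).le]
  -- `N = n + n + r`, `r < 2`, `n ≥ n₀`, `n ≥ 1`
  obtain ⟨n, r, hr, rfl⟩ : ∃ n r : ℕ, r < 2 ∧ N = n + n + r :=
    ⟨N / 2, N % 2, Nat.mod_lt N (by norm_num), by omega⟩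
  have hn : n₀ ≤ n := by omega
  have hn1 : 1 ≤ n := by omega
  have h1 : (tensorRank (kroneckerPow t (n + n + r)) : ℝ) ≤
      (tensorRank (kroneckerPow (kroneckerTensor t t) n) : ℝ) * M := by
    calc (tensorRank (kroneckerPow t (n + n + r)) : ℝ)
        ≤ ((tensorRank (kroneckerPow t (n + n)) * tensorRank (kroneckerPow t r) : ℕ) : ℝ) := by
          exact_mod_cast tensorRank_kroneckerPow_add_le t (n + n) r
      _ = (tensorRank (kroneckerPow t (n + n)) : ℝ) * tensorRank (kroneckerPow t r) := by push_cast; ring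
      _ ≤ (tensorRank (kroneckerPow (kroneckerTensor t t) n) : ℝ) * M :=
          mul_le_mul (by exact_mod_cast tensorRank_kroneckerPow_add_self_le t n) (hsmall r hr)
            (Nat.cast_nonneg _) (Nat.cast_nonneg _)
  have h2 : B ^ n ≤ c ^ ((1 + ε) * ((n + n + r : ℕ) : ℝ)) := by
    rw [hB, ← Real.rpow_mul_natCast hc0.le]
    refine Real.rpow_le_rpow_of_exponent_le hc1 ?_
    have : (0 : ℝ) ≤ r := Nat.cast_nonneg _
    push_cast
    nlinarith
  calc (tensorRank (kroneckerPow t (n + n + r)) : ℝ)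
      ≤ (tensorRank (kroneckerPow (kroneckerTensor t t) n) : ℝ) * M := h1
    _ ≤ B ^ n * M := mul_le_mul_of_nonneg_right (hD n hn hn1).le hM0
    _ ≤ c ^ ((1 + ε) * ((n + n + r : ℕ) : ℝ)) * M := mul_le_mul_of_nonneg_right h2 hM0
    _ = M * c ^ ((1 + ε) * ((n + n + r : ℕ) : ℝ)) := mul_comm _ _

end Growth

/-! ## The Levi-Civita tensor has signed Coppersmith–Winograd block structure -/

section LeviCivita

/-- **`ε^{⊗3m} ≥ ⟨p_m⟩ ⊗ ⟨2^m, 2^m, 2^m⟩`** for the Levi-Civita tensor `ε` of the crux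
`BDet3AsymptoticRank` (written inline exactly as in the route file), with
`288 C(2m,m) p_m ≥ C(3m,m) · rothNumberNat(3 C(2m,m))`: with respect to the blocks `{0} ∪ {1,2}`
the support of `ε` is `{(0,1,1),(1,0,1),(1,1,0)}` and each block is the skew form
`e₁ ⊗ e₂ - e₂ ⊗ e₁`, a signed permutation matrix (`σ = (1 2)`), so
`exists_restrictsTo_signedCw_kroneckerPow` applies ("`T_skewcw,q` has the same block structure as
`T_cw,q`", CGLV 2022 §2.2; `ε ≅ T_skewcw,2`, ibid. p. 7).
[cite: ConnerGesmundoLandsbergVentura2022, §2.2] -/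
theorem exists_restrictsTo_leviCivita_kroneckerPow (m : ℕ) (hm : 1 ≤ m) :
    ∃ p : ℕ, (3 * m).choose m * rothNumberNat (3 * (2 * m).choose m) ≤ 288 * (2 * m).choose m * p ∧
      TensorRestrictsTo
        (kroneckerPow (fun a b c : Fin 3 => (if b = a + 1 ∧ c = a + 2 then (1 : ℂ) else 0) -
          (if b = a + 2 ∧ c = a + 1 then 1 else 0)) (3 * m))
        (kroneckerTensor (unitTensor ℂ p) (matMulTensor ℂ (2 ^ m) (2 ^ m) (2 ^ m))) := by
  refine exists_restrictsTo_signedCw_kroneckerPow 2 m hm _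
    (Equiv.swap 0 1) (Equiv.swap 0 1) (Equiv.swap 0 1)
    (Equiv.injective _) (Equiv.injective _) (Equiv.injective _)
    (fun x => if x = 0 then 1 else -1) (fun x => if x = 0 then -1 else 1)
    (fun x => if x = 0 then 1 else -1) ?_ ?_ ?_ ?_ ?_ ?_ ?_
  · intro x; fin_cases x <;> simp
  · intro x; fin_cases x <;> simp
  · intro x; fin_cases x <;> simp
  · intro x y; fin_cases x <;> fin_cases y <;> simp
  · intro x y; fin_cases x <;> fin_cases y <;> simp
  · intro x y; fin_cases x <;> fin_cases y <;> simp
  · intro i j k h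
    fin_cases i <;> fin_cases j <;> fin_cases k <;> simp_all

end LeviCivita

/-! ## The glue -/

section Glue

/-- **`GlueDet3Omega` (item `stmt-MatrixMultiplication-1889`), proved unconditionally**:
`R̃(det₃) = 9 ⇒ ω(ℂ) = 2`. From `asymptoticRank (ε ⊠ ε) = 9 = 3²`, the ranks of the Kronecker
powers of the Levi-Civita tensor `ε` grow like `O(3^{(1+ε')N})`
(`isBigO_tensorRank_kroneckerPow_of_asymptoticRank_sq_le`); `ε` has the (signed) block structure
of `T_cw,2`, so the Coppersmith–Winograd bound (`omega_le_logb_of_laser_restrictions`, `q = 2`,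
`ρ = 3`) gives `ω(ℂ) ≤ log₂(4·27/27) = 2`; with `2 ≤ ω(ℂ)` (`omega_two_le`) the summit statement
`ω(ℂ) = 2` follows (CGLV 2022 §2.3: "`R̃(det₃) = 9` … would imply `ω = 2`").
[cite: ConnerGesmundoLandsbergVentura2022, §2.2–2.3] -/
theorem glueDet3Omega_proof :
    Summit.MatrixMultiplication.MatrixMultiplication.Theses.AsymptoticRankCW.GlueDet3Omega := by
  unfold Summit.MatrixMultiplication.MatrixMultiplication.Theses.AsymptoticRankCW.GlueDet3Omega
    Summit.MatrixMultiplication.MatrixMultiplication.Theses.AsymptoticRankCW.BDet3AsymptoticRank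
  intro hdet
  have h9 : asymptoticRank (kroneckerTensor
      (fun a b c : Fin 3 => (if b = a + 1 ∧ c = a + 2 then (1 : ℂ) else 0) -
        (if b = a + 2 ∧ c = a + 1 then 1 else 0))
      (fun a b c : Fin 3 => (if b = a + 1 ∧ c = a + 2 then (1 : ℂ) else 0) -
        (if b = a + 2 ∧ c = a + 1 then 1 else 0))) ≤ (3 : ℝ) ^ 2 := by
    rw [hdet]; norm_num
  have hyp := isBigO_tensorRank_kroneckerPow_of_asymptoticRank_sq_le _ 3 (by norm_num) h9
  have hω := omega_le_logb_of_laser_restrictions _ 2 le_rfl 3 (by norm_num)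
    exists_restrictsTo_leviCivita_kroneckerPow hyp
  rw [Nat.cast_ofNat, logb_two_cw_two] at hω
  exact le_antisymm hω (omega_two_le ℂ)

end Glue

end Summit.MatrixMultiplication.MatrixMultiplication.Theorems

end
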